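import Literature.NumberTheory.GaloisRepresentations.ContinuousCohomologyLongExact
import Literature.NumberTheory.GaloisRepresentations.ContinuousCohomologyConnecting
import HarnessLib

/-!
# The long exact cohomology sequence of a short exact sequence of discrete modules over a compact
# group, in every degree

For a compact topological group `Γ` and a short exact sequence `0 → M₁ →(f) M₂ →(g) M₃ → 0` of
discrete `Γ`-modules with jointly continuous `A`-linear actions (the tree's `ContinuousRep` and
`IsSES` of `DiscreteCochains.lean`), the complexes of homogeneous continuous cochains are degreewise
short exact (`cochainsHom_injective`, `cochainsHom_exact_mid`, `cochainsHom_surjective`, Shatz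
II §1 Prop. 2), so the homological-algebra layer `ContinuousCohomologyLongExact.lean` yields the
**long exact sequence of continuous cohomology in every degree `n`** (Shatz II §1 Prop. 3; Serre,
*Cohomologie galoisienne* I §2.2; NSW (1.3.2)), in element form for Mathlib's
`continuousCohomology n ρᵢ.toTopRep` and the induced maps `cohomologyMap f n`
(`ContinuousCohomologyConnecting.lean`):

* `IsSES.cohomologyMap_comp_apply_eq_zero'` : `Hⁿ(g) ∘ Hⁿ(f) = 0`;
* `IsSES.exists_cohomologyMap_eq_of_cohomologyMap_eq_zero` : exactness at `Hⁿ(Γ, M₂)`;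
* `IsSES.cohomologyMap_zero_injective` : `H⁰(f)` is injective;
* `IsSES.exists_connectingHom` : an `A`-linear connecting homomorphism
  `δ : Hⁿ(Γ, M₃) → Hⁿ⁺¹(Γ, M₁)` with exactness at `Hⁿ⁺¹(Γ, M₁)` (`ker Hⁿ⁺¹(f) ⊆ im δ`), exactness
  at `Hⁿ(Γ, M₃)` (`ker δ ⊆ im Hⁿ(g)`) and the vanishing of `δ ∘ Hⁿ(g)` and `Hⁿ⁺¹(f) ∘ δ`;
  `IsSES.exists_connectingHom_cochains` adds the cochain-level characterisation (snake recipe on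
  homogeneous cochains).

Until now the tree had the low-degree connecting maps `δ₀`, `δ₁` with inhomogeneous cocycle
formulas (`ContinuousCohomologyConnecting.lean`) and vanishing-form pieces
(`IsSES.subsingleton_X₁/X₃`); compatibility of the `δ` obtained here in degrees `0`, `1` with those
explicit maps is NOT asserted.

## References

* S. S. Shatz, *Profinite groups, arithmetic, and geometry*, Ann. of Math. Studies 67 (1972),
  Ch. II §1 Prop. 2, Prop. 3. [Shatz1972]
* J.-P. Serre, *Cohomologie galoisienne*, LNM 5 / *Galois Cohomology* (1997), I §2.2.
  [SerreGaloisCohomology1997]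
* J. Neukirch, A. Schmidt, K. Wingberg, *Cohomology of Number Fields*, 2nd ed. (2008), (1.3.2).
  [NeukirchSchmidtWingberg2008]
-/

noncomputable section

open CategoryTheory Limits

universe u

namespace Literature.NumberTheory.GaloisRepresentations

section SES

open _root_.TopRep _root_.ContRepresentation _root_.ContinuousCohomology

variable {A : Type*} [CommRing A] [TopologicalSpace A]
variable {Γ : Type u} [Group Γ] [TopologicalSpace Γ] [IsTopologicalGroup Γ] [CompactSpace Γ]
variable {M₁ : Type u} [AddCommGroup M₁] [Module A M₁] [TopologicalSpace M₁] [DiscreteTopology M₁]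
  [ContinuousSMul A M₁]
variable {M₂ : Type u} [AddCommGroup M₂] [Module A M₂] [TopologicalSpace M₂] [DiscreteTopology M₂]
  [ContinuousSMul A M₂]
variable {M₃ : Type u} [AddCommGroup M₃] [Module A M₃] [TopologicalSpace M₃] [DiscreteTopology M₃]
  [ContinuousSMul A M₃]
variable {ρ₁ : ContinuousRep Γ A M₁} {ρ₂ : ContinuousRep Γ A M₂} {ρ₃ : ContinuousRep Γ A M₃}

namespace IsSES

variable {f : ρ₁.toTopRep ⟶ ρ₂.toTopRep} {g : ρ₂.toTopRep ⟶ ρ₃.toTopRep}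

omit [CompactSpace Γ] in
/-- **`Hⁿ(g) ∘ Hⁿ(f) = 0`** on continuous cohomology, for a short exact sequence of discrete
modules, every degree. [cite: Shatz1972, Ch. II §1 Prop. 3] -/
theorem cohomologyMap_comp_apply_eq_zero' (h : IsSES f g) (n : ℕ)
    (a : continuousCohomology n ρ₁.toTopRep) :
    cohomologyMap g n (cohomologyMap f n a) = 0 :=
  homologyMap_comp_apply_eq_zero (cochainsHom f) (cochainsHom g)
    (cochainsHom_comp_apply_eq_zero f g h.comp_eq_zero) n a

/-- **Exactness at `Hⁿ(Γ, M₂)`, every degree**: a class killed by `Hⁿ(g)` comes from `Hⁿ(Γ, M₁)`.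
[cite: Shatz1972, Ch. II §1 Prop. 3] -/
theorem exists_cohomologyMap_eq_of_cohomologyMap_eq_zero (h : IsSES f g) (n : ℕ)
    (c : continuousCohomology n ρ₂.toTopRep) (hc : cohomologyMap g n c = 0) :
    ∃ a : continuousCohomology n ρ₁.toTopRep, cohomologyMap f n a = c :=
  exists_homologyMap_eq_of_homologyMap_eq_zero (cochainsHom f) (cochainsHom g)
    (cochainsHom_injective f h.injective) (cochainsHom_exact_mid f g h.injective h.exact_mid)
    (cochainsHom_surjective g h.surjective) n c hc

omit [CompactSpace Γ] in
/-- **`H⁰(f)` is injective** for a short exact sequence of discrete modules.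
[cite: Shatz1972, Ch. II §1 Prop. 3] -/
theorem cohomologyMap_zero_injective (h : IsSES f g) : Function.Injective (cohomologyMap f 0) :=
  homologyMap_zero_injective (cochainsHom f) (cochainsHom_injective f h.injective)

/-- **The connecting homomorphism with its cochain-level characterisation**: an `A`-linear
`δ : Hⁿ(Γ, M₃) → Hⁿ⁺¹(Γ, M₁)` with `δ [g ∘ b] = [x]` whenever `f ∘ x = d b` on homogeneous cochains
(`b` an invariant homogeneous `n`-cochain of `M₂`, `x` an `(n+1)`-cocycle of `M₁`).
[cite: Shatz1972, Ch. II §1 Prop. 3] [cite: NeukirchSchmidtWingberg2008, (1.3.2)] -/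
theorem exists_connectingHom_cochains (h : IsSES f g) (n : ℕ) :
    ∃ δ : continuousCohomology n ρ₃.toTopRep →ₗ[A] continuousCohomology (n + 1) ρ₁.toTopRep,
      ∀ (z : (homogeneousCochains ρ₃.toTopRep).X n)
        (hz : (homogeneousCochains ρ₃.toTopRep).d n (n + 1) z = 0)
        (b : (homogeneousCochains ρ₂.toTopRep).X n), (cochainsHom g).f n b = z →
        ∀ (x : (homogeneousCochains ρ₁.toTopRep).X (n + 1))
          (hdx : (homogeneousCochains ρ₁.toTopRep).d (n + 1) (n + 2) x = 0),
          (cochainsHom f).f (n + 1) x = (homogeneousCochains ρ₂.toTopRep).d n (n + 1) b →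
          δ (cxClass (homogeneousCochains ρ₃.toTopRep) n (n + 1) (up_nat_next n) z hz) =
            cxClass (homogeneousCochains ρ₁.toTopRep) (n + 1) (n + 2) (up_nat_next (n + 1))
              x hdx :=
  exists_connectingHom (cochainsHom f) (cochainsHom g) (cochainsHom_injective f h.injective)
    (cochainsHom_exact_mid f g h.injective h.exact_mid) (cochainsHom_surjective g h.surjective) n

/-- **The connecting homomorphism and the long exact sequence around it, every degree**: there is
an `A`-linear `δ : Hⁿ(Γ, M₃) → Hⁿ⁺¹(Γ, M₁)` such that `ker Hⁿ⁺¹(f) ⊆ im δ` (exactness at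
`Hⁿ⁺¹(Γ, M₁)`), `ker δ ⊆ im Hⁿ(g)` (exactness at `Hⁿ(Γ, M₃)`), `δ ∘ Hⁿ(g) = 0` and
`Hⁿ⁺¹(f) ∘ δ = 0`. [cite: Shatz1972, Ch. II §1 Prop. 3] [cite: SerreGaloisCohomology1997, I §2.2] -/
theorem exists_connectingHom (h : IsSES f g) (n : ℕ) :
    ∃ δ : continuousCohomology n ρ₃.toTopRep →ₗ[A] continuousCohomology (n + 1) ρ₁.toTopRep,
      (∀ c : continuousCohomology (n + 1) ρ₁.toTopRep, cohomologyMap f (n + 1) c = 0 →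
          ∃ γ, δ γ = c) ∧
      (∀ γ : continuousCohomology n ρ₃.toTopRep, δ γ = 0 → ∃ b, cohomologyMap g n b = γ) ∧
      (∀ b : continuousCohomology n ρ₂.toTopRep, δ (cohomologyMap g n b) = 0) ∧
      (∀ γ : continuousCohomology n ρ₃.toTopRep, cohomologyMap f (n + 1) (δ γ) = 0) := by
  have hcomp := cochainsHom_comp_apply_eq_zero f g h.comp_eq_zero
  have hinj := cochainsHom_injective f h.injective
  have hmid := cochainsHom_exact_mid f g h.injective h.exact_mid
  have hsurj := cochainsHom_surjective g h.surjective
  obtain ⟨δ, hδ⟩ := Literature.NumberTheory.GaloisRepresentations.exists_connectingHom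
    (cochainsHom f) (cochainsHom g) hinj hmid hsurj n
  exact ⟨δ, exists_connecting_eq_of_homologyMap_eq_zero hcomp hδ,
    exists_homologyMap_eq_of_connecting_eq_zero hcomp hinj hmid hsurj hδ,
    connecting_homologyMap_apply hδ, homologyMap_connecting_apply hinj hmid hsurj hδ⟩

end IsSES

end SES

end Literature.NumberTheory.GaloisRepresentations

end
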